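import Summits.BirchSwinnertonDyer.BirchSwinnertonDyer.Theorems.ResidualThetaTransportAtTwoResidualSignedLambdaLowerCMAtTwoCharIdealLengths
import Mathlib.LinearAlgebra.TensorProduct.Pi
import HarnessLib

/-!
# Blocks of the structure theorem over `Λ = A⟦X⟧` (`A` a complete DVR): `dim_K (K ⊗_A Λ/(gᵉ)) = e·dim_K (K ⊗_A Λ/(g))`
# by Weierstrass preparation, and pseudo-isomorphism invariance of `dim_K (K ⊗_A ·)` (two universes)

Route `ResidualThetaTransportAtTwo` (RTT), crux RSL_g `ResidualSignedLambdaLowerCMAtTwo` (stmt-BirchSwinnertonDyer-22608):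
STUB-PLAN rev 3 §3 Step 1 (the `Λ_𝒪` algebra kit). Seat `prover-bsd-wall-rtt-p2` g15 (`--supports`, closes nothing). Sequel of
`…CharIdealLengths`, prequel of `…CharIdealLambda` (the λ-identity and H-λchar). THEOREMS ONLY; pure commutative algebra;
BSD is not proved by any of this.

## What (`Λ = A⟦X⟧`, `A` a DVR with uniformiser `ϖ`, `K = Frac A`)
* §0 `subsingleton_baseChange_of_pow_smul_eq_zero` (`K ⊗_A Q = 0` if `ϖⁿQ = 0`); `pow_smul_eq_zero_of_C_pow_mem`;
  **`finrank_baseChange_eq_of_isPseudoIsomorphism'`** (pseudo-isomorphic `Λ`-modules in two universes have equal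
  `dim_K (K ⊗_A ·)`); `span_eq_span_C_of_map_residue_eq_zero` (a height-one prime `(g)` with `g ≡ 0 mod ϖ` is `(C ϖ)`).
* §1 (`A` complete) **`free_finite_finrank_quotient_span_pow`**: for a Weierstrass factorisation `g = f·h`,
  `Λ/(gᵉ) ≅ A[X]/(fᵉ)` is `A`-free of rank `e·deg f` (Mathlib's `IsWeierstrassFactorization.algEquivQuotient`);
  **`finite_and_finrank_baseChange_quotient_span_pow`**: for a height-one prime `𝔮 = (g)`,
  `dim_K (K ⊗_A Λ/(gᵉ)) = e · dim_K (K ⊗_A Λ/𝔮)` (both `0` when `𝔮 = (ϖ)`).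

References: [Washington1997] §13.2, Prop. 13.8 (remark on `𝒪` in place of `ℤ_p`); [Lang1990] Ch. 5 §2 Thm. 2.1–2.2;
[BourbakiAC5to7] VII §4.4.
-/

set_option autoImplicit false
-- the Theorems namespace of this sub repeats the summit name by design (D-0017 nested layout)
set_option linter.dupNamespace false

noncomputable section

open scoped TensorProduct Classical

namespace Summit.BirchSwinnertonDyer.BirchSwinnertonDyer.Theorems.CharIdealLambda

open Literature.NumberTheory.EllipticCurves

universe u v v' w

/-! ## §0 Base change kills `ϖ`-power torsion; pseudo-isomorphism invariance in two universes -/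

section DVR

variable {A : Type u} [CommRing A] [IsDomain A] [IsDiscreteValuationRing A]
variable (K : Type w) [Field K] [Algebra A K] [IsFractionRing A K]

omit [IsDiscreteValuationRing A] in
/-- A non-zero element of `A` is a unit of `K = Frac A`. [folklore] -/
theorem isUnit_algebraMap_of_ne_zero {a : A} (ha : a ≠ 0) : IsUnit (algebraMap A K a) :=
  IsLocalization.map_units K ⟨a, mem_nonZeroDivisors_of_ne_zero ha⟩

omit [IsDiscreteValuationRing A] in
/-- `K ⊗_A Q = 0` when a power of a non-zero `a ∈ A` kills `Q`. [folklore] -/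
theorem subsingleton_baseChange_of_pow_smul_eq_zero {a : A} (ha : a ≠ 0) {Q : Type v} [AddCommGroup Q] [Module A Q]
    (n : ℕ) (hQ : ∀ x : Q, a ^ n • x = 0) : Subsingleton (K ⊗[A] Q) := by
  have haK := isUnit_algebraMap_of_ne_zero K ha
  refine ⟨fun z w ↦ ?_⟩
  suffices h : ∀ z : K ⊗[A] Q, z = 0 by rw [h z, h w]
  intro z
  induction z using TensorProduct.induction_on with
  | zero => rfl
  | tmul c x => exact Module.tmul_eq_zero_of_pow_smul_eq_zero K haK (hQ x) c
  | add x y hx hy => rw [hx, hy, add_zero]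

omit [IsDomain A] [IsDiscreteValuationRing A] in
/-- `aⁿ` kills `Λ/I` as soon as `(C a)ⁿ ∈ I`. [folklore] -/
theorem pow_smul_eq_zero_of_C_pow_mem {I : Ideal (PowerSeries A)} {a : A} {n : ℕ}
    (h : (PowerSeries.C a : PowerSeries A) ^ n ∈ I) (x : PowerSeries A ⧸ I) : a ^ n • x = 0 := by
  obtain ⟨y, rfl⟩ := Ideal.Quotient.mk_surjective x
  rw [pow_smul_eq_C_pow_smul, ← Ideal.Quotient.mk_eq_mk, ← Submodule.Quotient.mk_smul, Submodule.Quotient.mk_eq_zero,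
    smul_eq_mul]
  exact Ideal.mul_mem_right _ _ h

/-- **Pseudo-isomorphic `A⟦X⟧`-modules have the same `dim_K (K ⊗_A ·)`** (two-universe form of
`…CharIdealLengths.finrank_baseChange_eq_of_isPseudoIsomorphism`, `K = Frac A`). [cite: Washington1997, §13.2] -/
theorem finrank_baseChange_eq_of_isPseudoIsomorphism' {P : Type v} {Q : Type v'} [AddCommGroup P]
    [Module (PowerSeries A) P] [Module A P] [IsScalarTower A (PowerSeries A) P] [AddCommGroup Q]
    [Module (PowerSeries A) Q] [Module A Q] [IsScalarTower A (PowerSeries A) Q] (f : P →ₗ[PowerSeries A] Q)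
    (hf : LinearMap.IsPseudoIsomorphism f) : Module.finrank K (K ⊗[A] P) = Module.finrank K (K ⊗[A] Q) := by
  obtain ⟨ϖ, hϖ⟩ := IsDiscreteValuationRing.exists_irreducible A
  have hϖm : ϖ ∈ IsLocalRing.maximalIdeal A :=
    (IsDiscreteValuationRing.irreducible_iff_uniformizer ϖ).mp hϖ ▸ Ideal.mem_span_singleton_self ϖ
  haveI : Module.Flat A K := IsLocalization.flat K (nonZeroDivisors A)
  refine Module.finrank_baseChange_eq_of_pow_smul K (isUnit_algebraMap_of_ne_zero K hϖ.ne_zero) (f.restrictScalars A)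
    (fun x hx ↦ ?_) (fun y ↦ ?_)
  · obtain ⟨n, hn⟩ := exists_C_pow_smul_eq_zero_of_isPseudoNull hϖm hf.1 ⟨x, hx⟩
    refine ⟨n, ?_⟩
    have hn' := congrArg Subtype.val hn
    simp only [SetLike.val_smul, ZeroMemClass.coe_zero] at hn'
    rwa [pow_smul_eq_C_pow_smul]
  · obtain ⟨n, hn⟩ := exists_C_pow_smul_eq_zero_of_isPseudoNull hϖm hf.2 (Submodule.Quotient.mk y)
    rw [← Submodule.Quotient.mk_smul, Submodule.Quotient.mk_eq_zero, LinearMap.mem_range] at hn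
    obtain ⟨x, hx⟩ := hn
    exact ⟨n, x, by rw [LinearMap.restrictScalars_apply, hx, pow_smul_eq_C_pow_smul]⟩

/-- If all coefficients of `g ∈ A⟦X⟧` lie in `𝔪_A = (ϖ)` then `C ϖ ∣ g`. [folklore] -/
theorem C_dvd_of_map_residue_eq_zero {ϖ : A} (hϖ : Irreducible ϖ) {g : PowerSeries A}
    (hres : PowerSeries.map (IsLocalRing.residue A) g = 0) : (PowerSeries.C ϖ : PowerSeries A) ∣ g := by
  have hdvd : ∀ n, ϖ ∣ PowerSeries.coeff n g := fun n ↦ by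
    have h := congrArg (PowerSeries.coeff n) hres
    rw [PowerSeries.coeff_map, map_zero, IsLocalRing.residue_eq_zero_iff,
      (IsDiscreteValuationRing.irreducible_iff_uniformizer ϖ).mp hϖ, Ideal.mem_span_singleton] at h
    exact h
  choose b hb using hdvd
  exact ⟨PowerSeries.mk b, by ext n; rw [PowerSeries.coeff_C_mul, PowerSeries.coeff_mk, hb]⟩

/-- A height-one prime `𝔮 = (g)` of `A⟦X⟧` with `g ≡ 0 (mod ϖ)` IS `(C ϖ)`. [cite: Washington1997, §13.2] -/
theorem span_eq_span_C_of_map_residue_eq_zero {ϖ : A} (hϖ : Irreducible ϖ) (𝔮 : PrimeSpectrum (PowerSeries A))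
    (h𝔮 : 𝔮.asIdeal.height = 1) {g : PowerSeries A} (hg : 𝔮.asIdeal = Ideal.span {g})
    (hres : PowerSeries.map (IsLocalRing.residue A) g = 0) :
    Ideal.span {g} = Ideal.span {(PowerSeries.C ϖ : PowerSeries A)} := by
  have hC : Prime (PowerSeries.C ϖ : PowerSeries A) := prime_C_of_prime hϖ.prime
  haveI : (Ideal.span {(PowerSeries.C ϖ : PowerSeries A)}).IsPrime := (Ideal.span_singleton_prime hC.ne_zero).mpr hC
  haveI : (Ideal.span {g}).IsPrime := hg ▸ 𝔮.isPrime
  have hne : Ideal.span {g} ≠ ⊥ := by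
    rw [← hg, Ne, ← Ideal.height_eq_zero_iff_eq_bot, h𝔮]; exact one_ne_zero
  exact Module.eq_of_height_le_one_of_le (le_of_eq (Module.height_span_singleton_eq_one_of_prime hC)) hne
    (Ideal.span_singleton_le_span_singleton.mpr (C_dvd_of_map_residue_eq_zero hϖ hres))

end DVR

/-! ## §1 Blocks `Λ/(gᵉ)` over a complete DVR: Weierstrass preparation -/

section Complete

variable {A : Type u} [CommRing A] [IsDomain A] [IsDiscreteValuationRing A]
  [IsAdicComplete (IsLocalRing.maximalIdeal A) A]
variable (K : Type w) [Field K] [Algebra A K] [IsFractionRing A K]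

/-- **`Λ/(gᵉ) ≅ A[X]/(fᵉ)` is free of rank `e·deg f` over `A`** for a Weierstrass factorisation `g = f·h`
(`f` distinguished, `h` a unit). [cite: Washington1997, Prop. 13.8] [cite: Lang1990, Ch. 5 §2 Thm. 2.1] -/
theorem free_finite_finrank_quotient_span_pow {g h : PowerSeries A} {f : Polynomial A}
    (H : g.IsWeierstrassFactorization f h) (e : ℕ) :
    Module.Free A (PowerSeries A ⧸ Ideal.span {g ^ e}) ∧ Module.Finite A (PowerSeries A ⧸ Ideal.span {g ^ e}) ∧
      Module.finrank A (PowerSeries A ⧸ Ideal.span {g ^ e}) = e * f.natDegree := by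
  have He : (g ^ e).IsWeierstrassFactorization (f ^ e) (h ^ e) :=
    ⟨isDistinguishedAt_pow H.isDistinguishedAt e, H.isUnit.pow e, by rw [H.eq_mul, mul_pow, Polynomial.coe_pow]⟩
  have hmon : (f ^ e).Monic := H.isDistinguishedAt.monic.pow e
  haveI := hmon.free_quotient
  haveI := hmon.finite_quotient
  let E := He.algEquivQuotient.toLinearEquiv
  exact ⟨Module.Free.of_equiv E, Module.Finite.equiv E,
    by rw [← E.finrank_eq, finrank_quotient_span_eq_natDegree' hmon, H.isDistinguishedAt.monic.natDegree_pow]⟩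

/-- `Λ/(g) ≅ A[X]/(f)` is free of rank `deg f` over `A` for a Weierstrass factorisation `g = f·h` (the case `e = 1`, stated
separately because `g ^ 1` and `g` give syntactically different quotient types). [cite: Washington1997, Prop. 13.8] -/
theorem free_finite_finrank_quotient_span {g h : PowerSeries A} {f : Polynomial A}
    (H : g.IsWeierstrassFactorization f h) :
    Module.Free A (PowerSeries A ⧸ Ideal.span {g}) ∧ Module.Finite A (PowerSeries A ⧸ Ideal.span {g}) ∧
      Module.finrank A (PowerSeries A ⧸ Ideal.span {g}) = f.natDegree := by
  have hmon : f.Monic := H.isDistinguishedAt.monic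
  haveI := hmon.free_quotient
  haveI := hmon.finite_quotient
  let E := H.algEquivQuotient.toLinearEquiv
  exact ⟨Module.Free.of_equiv E, Module.Finite.equiv E, by rw [← E.finrank_eq, finrank_quotient_span_eq_natDegree' hmon]⟩

/-- **Block dimension.** For a height-one prime `𝔮 = (g)` of `Λ = A⟦X⟧` and `e : ℕ`, `K ⊗_A Λ/(gᵉ)` is
finite-dimensional and `dim_K (K ⊗_A Λ/(gᵉ)) = e · dim_K (K ⊗_A Λ/𝔮)` (`= e·deg f` via Weierstrass if `g ∉ (ϖ)`, `= 0`
if `𝔮 = (ϖ)`). [cite: Washington1997, §13.2 and Prop. 13.8] -/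
theorem finite_and_finrank_baseChange_quotient_span_pow (𝔮 : PrimeSpectrum (PowerSeries A))
    (h𝔮 : 𝔮.asIdeal.height = 1) {g : PowerSeries A} (hg : 𝔮.asIdeal = Ideal.span {g}) (e : ℕ) :
    Module.Finite K (K ⊗[A] (PowerSeries A ⧸ Ideal.span {g ^ e})) ∧
      Module.finrank K (K ⊗[A] (PowerSeries A ⧸ Ideal.span {g ^ e})) =
        e * Module.finrank K (K ⊗[A] (PowerSeries A ⧸ 𝔮.asIdeal)) := by
  rw [hg]
  obtain ⟨ϖ, hϖ⟩ := IsDiscreteValuationRing.exists_irreducible A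
  by_cases hres : PowerSeries.map (IsLocalRing.residue A) g = 0
  · have heq := span_eq_span_C_of_map_residue_eq_zero hϖ 𝔮 h𝔮 hg hres
    have hmem : ∀ k, (PowerSeries.C ϖ : PowerSeries A) ^ k ∈ Ideal.span {g ^ k} := fun k ↦ by
      rw [← Ideal.span_singleton_pow, heq, Ideal.span_singleton_pow]; exact Ideal.mem_span_singleton_self _
    have hmem1 : (PowerSeries.C ϖ : PowerSeries A) ^ 1 ∈ Ideal.span {g} := by
      rw [pow_one, heq]; exact Ideal.mem_span_singleton_self _
    haveI h1 : Subsingleton (K ⊗[A] (PowerSeries A ⧸ Ideal.span {g ^ e})) :=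
      subsingleton_baseChange_of_pow_smul_eq_zero K hϖ.ne_zero e (pow_smul_eq_zero_of_C_pow_mem (hmem e))
    haveI h2 : Subsingleton (K ⊗[A] (PowerSeries A ⧸ Ideal.span {g})) :=
      subsingleton_baseChange_of_pow_smul_eq_zero K hϖ.ne_zero 1 (pow_smul_eq_zero_of_C_pow_mem hmem1)
    exact ⟨Module.Finite.of_finite, by rw [Module.finrank_zero_of_subsingleton, Module.finrank_zero_of_subsingleton, mul_zero]⟩
  · obtain ⟨f, h, H⟩ := PowerSeries.exists_isWeierstrassFactorization hres
    obtain ⟨hF, hFin, hrk⟩ := free_finite_finrank_quotient_span_pow H e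
    obtain ⟨hF1, hFin1, hrk1⟩ := free_finite_finrank_quotient_span H
    haveI := hF; haveI := hFin; haveI := hF1; haveI := hFin1
    exact ⟨inferInstance, by rw [Module.finrank_baseChange, Module.finrank_baseChange, hrk, hrk1]⟩

end Complete

end Summit.BirchSwinnertonDyer.BirchSwinnertonDyer.Theorems.CharIdealLambda

end
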